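import Summits.RiemannHypothesis.RiemannHypothesis.Theorems.SemilocalDeletionToeplitzBandEdgeDeficit
import Mathlib.Analysis.SpecialFunctions.Trigonometric.Sinc
import HarnessLib

/-!
# The band-edge deficit has an EXACT asymptotic constant: `(m+2)²·(F_p − μ_m(p)) → π²κ_p/2`

`SemilocalDeletionToeplitzBandEdge` / `…Deficit` / `…Combs` pin the sharp finite-window floor `μ_m(p) = −λ_min(A_m(p))` of one prime in
`[F̌_p(m), F̂_p(m)]` with `F_p − F̂_p(m) = 2log p(1−c_m)√p(√p−1)/((√p+1)(p+2c_m√p+1))`, `c_m = cos(π/(m+2))`, and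
`0 ≤ F̂_p(m) − F̌_p(m) ≤ 4π²log p(p+√p)/(p(p+1)(m+2)³)`.  Here both closed forms are shown to share ONE second-order constant:

* `tendsto_sq_mul_one_sub_cos`: `(m+2)²·(1 − cos(π/(m+2))) → π²/2` (`1 − cos x = 2sin²(x/2)` and `sinc → 1`);
* `tendsto_sq_mul_allWindow_sub_bandEdge` (★): `(m+2)²·(F_p − F̂_p(m)) → π²κ_p/2`, `κ_p = 2log p·√p(√p−1)/(√p+1)³`;
* `bandEdgeComb_le_bandEdge`: `F̌_p(m) ≤ F̂_p(m)`; `tendsto_sq_mul_allWindow_sub_bandEdgeComb` (★): `(m+2)²·(F_p − F̌_p(m)) → π²κ_p/2` too.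

So the single-prime floor deficit is `F_p − μ_m(p) ∼ π²κ_p/(2(m+2)²)`, i.e. in bandwidth `b` (`m+2 ≈ 2b/log p`)
`b²(F_p − μ*_p(b)) → c_p := π²(log p)³√p(√p−1)/(4(√p+1)³)` (`c₂ = 0.0342`, `c₃ = 0.2034`, `c₅ = 0.839`, `c₇ = 1.634`), the parameter-free
constants that gen17's lattice data approach (`p = 2`: `0.031` at `b ≤ 6`; pair (2,3): `b²(F₂+F₃−μ*_{23}) = 0.2380` at `b = 12` vs `c₂+c₃ = 0.2376`,
HOME/cc-s2-1/gen18/BAND-EDGE.md §5).  Nothing here bears on RH; these are statements about truncated Weil forms.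
-/

set_option linter.dupNamespace false

noncomputable section

open Complex Filter Set MeasureTheory
open scoped Real Topology ComplexConjugate

namespace Summit.RiemannHypothesis.RiemannHypothesis.Theorems.SemilocalDeletionToeplitzBandEdgeAsymptotic

open Literature.NumberTheory.LFunctions
open Summit.RiemannHypothesis.RiemannHypothesis.Theorems.SemilocalDeletionToeplitzBandEdge
open Summit.RiemannHypothesis.RiemannHypothesis.Theorems.SemilocalDeletionToeplitzBandEdgeDeficit

/-- `π/(m+2) → 0` along `m → ∞`. -/
theorem tendsto_pi_div : Tendsto (fun m : ℕ ↦ π / ((m : ℝ) + 2)) atTop (𝓝 0) :=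
  Tendsto.div_atTop tendsto_const_nhds (tendsto_natCast_atTop_atTop.atTop_add tendsto_const_nhds)

/-- `cos(π/(m+2)) → 1`. -/
theorem tendsto_cos_weight : Tendsto (fun m : ℕ ↦ Real.cos (π / ((m : ℝ) + 2))) atTop (𝓝 1) := by
  have h := (Real.continuous_cos.tendsto 0).comp tendsto_pi_div
  rwa [Real.cos_zero] at h

/-- **`(m+2)²·(1 − cos(π/(m+2))) → π²/2`** (`1 − cos x = 2sin²(x/2)`, `sin y/y = sinc y → 1`). -/
theorem tendsto_sq_mul_one_sub_cos :
    Tendsto (fun m : ℕ ↦ ((m : ℝ) + 2) ^ 2 * (1 - Real.cos (π / ((m : ℝ) + 2)))) atTop (𝓝 (π ^ 2 / 2)) := by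
  -- `y_m = π/(2(m+2)) → 0`, `sinc y_m → 1`
  have hy : Tendsto (fun m : ℕ ↦ π / ((m : ℝ) + 2) / 2) atTop (𝓝 0) := by
    simpa using tendsto_pi_div.div_const 2
  have hsinc : Tendsto (fun m : ℕ ↦ Real.sinc (π / ((m : ℝ) + 2) / 2)) atTop (𝓝 1) := by
    have h := (Real.continuous_sinc.tendsto 0).comp hy
    rwa [Real.sinc_zero] at h
  have hlim : Tendsto (fun m : ℕ ↦ π ^ 2 / 2 * Real.sinc (π / ((m : ℝ) + 2) / 2) ^ 2) atTop (𝓝 (π ^ 2 / 2)) := by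
    have := (hsinc.pow 2).const_mul (π ^ 2 / 2)
    simpa using this
  refine hlim.congr fun m ↦ ?_
  have hm : (0 : ℝ) < (m : ℝ) + 2 := by positivity
  have hy0 : π / ((m : ℝ) + 2) / 2 ≠ 0 := by positivity
  rw [Real.sinc_of_ne_zero hy0]
  have hcos : Real.cos (π / ((m : ℝ) + 2)) = 1 - 2 * Real.sin (π / ((m : ℝ) + 2) / 2) ^ 2 := by
    have e : π / ((m : ℝ) + 2) = 2 * (π / ((m : ℝ) + 2) / 2) := by ring
    conv_lhs => rw [e]
    rw [Real.cos_two_mul]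
    nlinarith [Real.sin_sq_add_cos_sq (π / ((m : ℝ) + 2) / 2)]
  rw [hcos]
  field_simp
  ring

variable {p : ℕ}

/-- **★ `(m+2)²·(F_p − F̂_p(m)) → π²κ_p/2`**, `κ_p = 2log p·√p(√p−1)/(√p+1)³` — the band-edge certificate's deficit has an exact
second-order constant. -/
theorem tendsto_sq_mul_allWindow_sub_bandEdge (hp : p.Prime) :
    Tendsto (fun m : ℕ ↦ ((m : ℝ) + 2) ^ 2 * (2 * Real.log p / (Real.sqrt p + 1) -
        2 * Real.log p * (1 + Real.cos (π / (m + 2)) * Real.sqrt p) / (p + 2 * Real.cos (π / (m + 2)) * Real.sqrt p + 1)))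
      atTop (𝓝 (π ^ 2 / 2 * (2 * Real.log p * (Real.sqrt p * (Real.sqrt p - 1)) / (Real.sqrt p + 1) ^ 3))) := by
  have hp0 : (0 : ℝ) < p := by exact_mod_cast hp.pos
  set r := Real.sqrt (p : ℝ) with hr
  have hr0 : 0 < r := Real.sqrt_pos.2 hp0
  have hpr : (p : ℝ) = r ^ 2 := (Real.sq_sqrt hp0.le).symm
  set L := Real.log (p : ℝ) with hL
  -- the second factor `2L r(r−1)/((r+1)(p + 2c_m r + 1)) → 2L r(r−1)/((r+1)(r+1)²)`
  have hden : Tendsto (fun m : ℕ ↦ (r + 1) * ((p : ℝ) + 2 * Real.cos (π / ((m : ℝ) + 2)) * r + 1)) atTop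
      (𝓝 ((r + 1) * ((p : ℝ) + 2 * 1 * r + 1))) :=
    ((tendsto_cos_weight.const_mul 2).mul_const r |>.const_add (p : ℝ) |>.add_const 1).const_mul (r + 1)
  have hden0 : (r + 1) * ((p : ℝ) + 2 * 1 * r + 1) ≠ 0 := by positivity
  have hfac : Tendsto (fun m : ℕ ↦ 2 * L * (r * (r - 1)) / ((r + 1) * ((p : ℝ) + 2 * Real.cos (π / ((m : ℝ) + 2)) * r + 1)))
      atTop (𝓝 (2 * L * (r * (r - 1)) / ((r + 1) * ((p : ℝ) + 2 * 1 * r + 1)))) :=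
    tendsto_const_nhds.div hden hden0
  have hprod := tendsto_sq_mul_one_sub_cos.mul hfac
  have hlim_eq : π ^ 2 / 2 * (2 * L * (r * (r - 1)) / ((r + 1) * ((p : ℝ) + 2 * 1 * r + 1))) =
      π ^ 2 / 2 * (2 * L * (r * (r - 1)) / (r + 1) ^ 3) := by
    rw [hpr]; ring
  rw [hlim_eq] at hprod
  refine hprod.congr fun m ↦ ?_
  have hm : ((m : ℕ) : ℝ) + 2 = (m : ℝ) + 2 := rfl
  rw [allWindow_sub_bandEdge_eq hp m]
  ring

/-- `F̌_p(m) ≤ F̂_p(m)` (the comb value never exceeds the certificate value). -/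
theorem bandEdgeComb_le_bandEdge (hp : p.Prime) (m : ℕ) :
    2 * Real.log p * (1 + Real.cos (π / (m + 2)) * Real.sqrt p - 2 * Real.sin (π / (m + 2)) ^ 2 / (m + 2)) /
        (p + 2 * Real.cos (π / (m + 2)) * Real.sqrt p + 1 - 2 * Real.sin (π / (m + 2)) ^ 2 / (m + 2)) ≤
      2 * Real.log p * (1 + Real.cos (π / (m + 2)) * Real.sqrt p) / (p + 2 * Real.cos (π / (m + 2)) * Real.sqrt p + 1) := by
  have hp1 : (1 : ℝ) < p := by exact_mod_cast hp.one_lt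
  have hL : 0 ≤ Real.log p := Real.log_nonneg hp1.le
  have hc0 : 0 ≤ Real.cos (π / (m + 2)) := cos_weight_nonneg m
  have hr0 : 0 ≤ Real.sqrt (p : ℝ) := Real.sqrt_nonneg _
  set L := Real.log (p : ℝ)
  set c := Real.cos (π / (m + 2))
  set r := Real.sqrt (p : ℝ)
  set ε := 2 * Real.sin (π / (m + 2)) ^ 2 / ((m : ℝ) + 2) with hε
  have hm : (0 : ℝ) < (m : ℝ) + 2 := by positivity
  have hε0 : 0 ≤ ε := by positivity
  have hε1 : ε ≤ 1 := by
    have hs1 : Real.sin (π / (m + 2)) ^ 2 ≤ 1 := Real.sin_sq_le_one _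
    rw [hε, div_le_one hm]; linarith [(Nat.cast_nonneg m : (0 : ℝ) ≤ m)]
  have h2c : 0 ≤ 2 * c * r := by positivity
  have hD : 0 < (p : ℝ) + 2 * c * r + 1 := by linarith
  have hDε : 0 < (p : ℝ) + 2 * c * r + 1 - ε := by linarith
  rw [div_le_div_iff₀ hDε hD]
  -- `2L(1+cr−ε)·D ≤ 2L(1+cr)·(D−ε)` ⟺ `2Lε(1+cr) ≤ 2LεD`... i.e. `ε·2L·(p + cr) ≥ 0`
  have hcr : 0 ≤ c * r := by positivity
  have hp0 : (0 : ℝ) ≤ p := by positivity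
  nlinarith [mul_nonneg (mul_nonneg hε0 hL) (add_nonneg hp0 hcr)]

/-- **★ `(m+2)²·(F_p − F̌_p(m)) → π²κ_p/2`** as well (squeeze: `0 ≤ F̂ − F̌ ≤ C/(m+2)³`): certificate and comb share the
second-order constant, so the sharp floor `μ_m(p) ∈ [F̌_p(m), F̂_p(m)]` satisfies `F_p − μ_m(p) ∼ π²κ_p/(2(m+2)²)`. -/
theorem tendsto_sq_mul_allWindow_sub_bandEdgeComb (hp : p.Prime) :
    Tendsto (fun m : ℕ ↦ ((m : ℝ) + 2) ^ 2 * (2 * Real.log p / (Real.sqrt p + 1) -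
        2 * Real.log p * (1 + Real.cos (π / (m + 2)) * Real.sqrt p - 2 * Real.sin (π / (m + 2)) ^ 2 / (m + 2)) /
          (p + 2 * Real.cos (π / (m + 2)) * Real.sqrt p + 1 - 2 * Real.sin (π / (m + 2)) ^ 2 / (m + 2))))
      atTop (𝓝 (π ^ 2 / 2 * (2 * Real.log p * (Real.sqrt p * (Real.sqrt p - 1)) / (Real.sqrt p + 1) ^ 3))) := by
  -- split `F − F̌ = (F − F̂) + (F̂ − F̌)` and show `(m+2)²(F̂ − F̌) → 0`
  have hp0 : (0 : ℝ) < p := by exact_mod_cast hp.pos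
  have hmain := tendsto_sq_mul_allWindow_sub_bandEdge hp
  have hsmall : Tendsto (fun m : ℕ ↦ ((m : ℝ) + 2) ^ 2 *
      (2 * Real.log p * (1 + Real.cos (π / (m + 2)) * Real.sqrt p) / (p + 2 * Real.cos (π / (m + 2)) * Real.sqrt p + 1) -
        2 * Real.log p * (1 + Real.cos (π / (m + 2)) * Real.sqrt p - 2 * Real.sin (π / (m + 2)) ^ 2 / (m + 2)) /
          (p + 2 * Real.cos (π / (m + 2)) * Real.sqrt p + 1 - 2 * Real.sin (π / (m + 2)) ^ 2 / (m + 2)))) atTop (𝓝 0) := by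
    -- `0 ≤ (m+2)²(F̂ − F̌) ≤ K/(m+2)`, `K = 4π² log p (p+√p)/(p(p+1))`
    have hK : Tendsto (fun m : ℕ ↦ 4 * π ^ 2 * Real.log p * (p + Real.sqrt p) / (p * (p + 1)) / ((m : ℝ) + 2))
        atTop (𝓝 0) :=
      Tendsto.div_atTop tendsto_const_nhds (tendsto_natCast_atTop_atTop.atTop_add tendsto_const_nhds)
    refine tendsto_of_tendsto_of_tendsto_of_le_of_le tendsto_const_nhds hK (fun m ↦ ?_) (fun m ↦ ?_)
    · exact mul_nonneg (sq_nonneg _) (sub_nonneg.mpr (bandEdgeComb_le_bandEdge hp m))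
    · have h := bandEdge_sub_bandEdgeComb_le hp m
      have hm : (0 : ℝ) < (m : ℝ) + 2 := by positivity
      calc ((m : ℝ) + 2) ^ 2 * _ ≤ ((m : ℝ) + 2) ^ 2 *
            (4 * π ^ 2 * Real.log p * (p + Real.sqrt p) / (p * (p + 1) * ((m : ℝ) + 2) ^ 3)) :=
            mul_le_mul_of_nonneg_left h (sq_nonneg _)
        _ = 4 * π ^ 2 * Real.log p * (p + Real.sqrt p) / (p * (p + 1)) / ((m : ℝ) + 2) := by
            field_simp
  have hsum := hmain.add hsmall
  rw [add_zero] at hsum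
  refine hsum.congr fun m ↦ ?_
  ring

end Summit.RiemannHypothesis.RiemannHypothesis.Theorems.SemilocalDeletionToeplitzBandEdgeAsymptotic

end
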